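import Summits.KontsevichZagierPeriods.KontsevichZagierPeriods.Theorems.HurwitzMicroSectorsNormalFormPrincipleIslandSplitQV
import Summits.KontsevichZagierPeriods.KontsevichZagierPeriods.Theorems.HurwitzMicroSectorsNormalFormPrincipleIslandChartW
import Summits.KontsevichZagierPeriods.KontsevichZagierPeriods.Theorems.HurwitzMicroSectorsNormalFormPrincipleIslandDissectP
import Summits.KontsevichZagierPeriods.KontsevichZagierPeriods.Theorems.HurwitzMicroSectorsNormalFormPrincipleIslandPartialFractionT
import Summits.KontsevichZagierPeriods.KontsevichZagierPeriods.Theorems.HurwitzMicroSectorsNormalFormPrincipleIslandCarriers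
import Summits.KontsevichZagierPeriods.KontsevichZagierPeriods.Theorems.MzvKernelInKZ.Negative.ScalingDivision
import Summits.KontsevichZagierPeriods.KontsevichZagierPeriods.Theorems.HyperbolicBlochOffTetraSectorKernelStubAffineOrbit
import Literature.NumberTheory.Transcendental.KZProductIdeal

/-!
# `NormalFormPrinciple` (stmt-KontsevichZagierPeriods-3869), line `SketchIdeator1` —
# leaf `stub_boxRigidity`: the PRODUCT ISLAND at height `q` (kernel capstone and the two pair theorems)

Pure proof file (lead seat c9; `--supports` the crux; strategist idea `product-island-vz`). For an
integer `q ≥ 2` the eight atoms `1, 1/(q−x), 1/(q−y), 1/(q−xy), 1/((q−x)(q−y)), 1/((q−x)(q−xy)),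
1/((q−y)(q−xy)), 1/((q−x)(q−y)(q−xy))` on the open square have values `1, ℓ, ℓ, L₂, ℓ², V, V, T`
with `ℓ = ∫₀¹dt/(q−t) = log(q/(q−1))`, `L₂ = ∫∫dxdy/(q−xy) = Li₂(1/q)`, and the two
transcendence-FREE coincidences `2qV = 2L₂ + ℓ²`, `q(q−1)T = L₂` are MOVE CHAINS of the calculus
(rule (1b) split, the chart `(x, xy)` onto the triangle, the dissection of the symmetric box into two
triangles, the four-term partial fraction — the registered stubs `isl_*`). Hence every element `c` of
the subgroup generated by the atoms satisfies `2q(q−1)·c ≡ α[1] + β[1/(q−x)] + γ[1/(q−xy)] + δ[1/((q−x)(q−y))]`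
modulo `KZ.relations`, and the `ℚ`-linear independence of `1, ℓ, L₂, ℓ²` (Viola–Zudilin 2018, a
theorem for `q ≥ 9`; here the HYPOTHESIS `hrig`, stated on the integrals themselves) makes a
vanishing value a relation: Conjecture 1 in kernel form on the product island, the first closed sector
of this line with a PRODUCT period (`ℓ²`). References: M. Kontsevich, D. Zagier, *Periods* (2001), §1.2;
C. Viola, W. Zudilin, *Linear independence of dilogarithmic values*, J. reine angew. Math. 736 (2018), Thm 1.
No definitions are introduced.
-/

noncomputable section

open MeasureTheory Set
open Literature.NumberTheory.Transcendental Literature.NumberTheory.Transcendental.KZ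
open Summit.KontsevichZagierPeriods.MzvKernelInKZ.Negative (mem_relations_of_nsmul_mem)
open Summit.KontsevichZagierPeriods.HyperbolicBloch.OffTetraSectorKernel
  (aff_orbit_of_sub_sum_zsmul_mem_relations)

namespace Summit.KontsevichZagierPeriods.HurwitzMicroSectors.NormalFormPrinciple.PiBox.Island

/-- Coordinate facts on the open square at height `q ≥ 2`: every island denominator is `≥ 1`. [folklore] -/
theorem islk_box_facts {q : ℕ} (hq : 2 ≤ q) {x : Fin 2 → ℝ} (hx : x ∈ {x : Fin 2 → ℝ | ∀ i, x i ∈ Set.Ioo (0:ℝ) 1}) :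
    0 < x 0 ∧ x 0 < 1 ∧ 0 < x 1 ∧ x 1 < 1 ∧ 1 ≤ (q:ℝ) - x 0 ∧ 1 ≤ (q:ℝ) - x 1 ∧ 1 ≤ (q:ℝ) - x 0 * x 1 := by
  have hq' : (2:ℝ) ≤ q := by exact_mod_cast hq
  have h0 := hx 0; have h1 := hx 1
  refine ⟨h0.1, h0.2, h1.1, h1.2, by linarith [h0.2], by linarith [h1.2], ?_⟩
  nlinarith [h0.1, h0.2, h1.1, h1.2]

/-- **A scaled atom**: if `R.integrand = k · N.integrand` on the common box then `[R] − k•[N] ∈ relations`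
(rule (1b)). [cite: KontsevichZagier2001, §1.2 rule (1)] -/
theorem islk_of_sub_nsmul (k : ℕ) (N R : IntegralRep 2) (hd : N.domain = R.domain)
    (h : ∀ x ∈ R.domain, R.integrand x = (k:ℝ) * N.integrand x) : of R - (k:ℕ) • of N ∈ relations := by
  have h1 := aff_orbit_of_sub_sum_zsmul_mem_relations (Finset.univ : Finset (Fin 1)) ![N] ![(k:ℤ)] R
    (fun i _ => by fin_cases i; exact hd) fun x hx => by
      simp only [Finset.univ_unique, Fin.default_eq_zero, Finset.sum_singleton, Matrix.cons_val_fin_one]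
      push_cast
      exact h x hx
  simpa using h1

/-- **The swap**: two box representations whose integrands are each other's coordinate swap are
congruent (rule (2), the linear bijection `(x,y) ↦ (y,x)`). [cite: KontsevichZagier2001, §1.2 rule (2)] -/
theorem islk_swap (N N' : IntegralRep 2) (f : (Fin 2 → ℝ) → ℝ)
    (hNd : N.domain = {x | ∀ i, x i ∈ Set.Ioo (0:ℝ) 1}) (hNi : EqOn N.integrand f N.domain)
    (hN'd : N'.domain = {x | ∀ i, x i ∈ Set.Ioo (0:ℝ) 1}) (hN'i : EqOn N'.integrand (fun x => f ![x 1, x 0]) N'.domain) :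
    of N' - of N ∈ relations := by
  set e : Fin 2 ≃ Fin 2 := Equiv.swap 0 1 with he
  have h1 : of N - of (N.reindex e) ∈ relations := of_sub_of_reindex_mem_relations N e
  have hRd : (N.reindex e).domain = {x | ∀ i, x i ∈ Set.Ioo (0:ℝ) 1} := by
    rw [IntegralRep.reindex_domain, hNd]
    ext y
    simp only [mem_setOf_eq]
    constructor
    · intro h i
      have := h (e i)
      simpa [he, Equiv.swap_apply_self] using this
    · intro h i
      exact h (e i)
  have h2 : of (N.reindex e) - of N' ∈ relations := by
    refine of_sub_of_mem_relations_of_eqOn (hN'd.trans hRd.symm) fun y hy => ?_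
    have hy' : (fun i => y (e i)) ∈ N.domain := by
      rw [IntegralRep.reindex_domain] at hy; exact hy
    show N.integrand (fun i => y (e i)) = N'.integrand y
    rw [hNi hy', hN'i (by rw [hN'd, ← hRd]; exact hy)]
    congr 1
    ext i
    fin_cases i <;> simp [he]
  have e1 : of N' - of N = -((of N - of (N.reindex e)) + (of (N.reindex e) - of N')) := by abel
  rw [e1]
  exact relations.neg_mem (relations.add_mem h1 h2)

/-- **The two move chains of the island** (from the registered stubs): carriers `Vq = [□², q/((q−x)(q−xy))]`,
`D = [□², 1/(q−xy)]`, `P = [□², 1/((q−x)(q−y))]`, `Tq = [□², q(q−1)/((q−x)(q−y)(q−xy))]` with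
`2[Vq] ≡ 2[D] + [P]` (split + chart + dissection) and `[Tq] ≡ [D]` (partial fraction + swap).
[cite: KontsevichZagier2001, §1.2 rules (1), (2)] -/
theorem islk_chains (q : ℕ) (hq : 2 ≤ q) :
    ∃ (Vq D P Tq : IntegralRep 2),
      Vq.domain = {x | ∀ i, x i ∈ Set.Ioo (0:ℝ) 1} ∧
      (Vq.integrand = fun x => (q:ℝ) / (((q:ℝ) - x 0) * ((q:ℝ) - x 0 * x 1))) ∧
      D.domain = {x | ∀ i, x i ∈ Set.Ioo (0:ℝ) 1} ∧ (D.integrand = fun x => 1 / ((q:ℝ) - x 0 * x 1)) ∧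
      P.domain = {x | ∀ i, x i ∈ Set.Ioo (0:ℝ) 1} ∧
      (P.integrand = fun x => 1 / (((q:ℝ) - x 0) * ((q:ℝ) - x 1))) ∧
      Tq.domain = {x | ∀ i, x i ∈ Set.Ioo (0:ℝ) 1} ∧
      (Tq.integrand = fun x => (q:ℝ) * ((q:ℝ) - 1) /
        (((q:ℝ) - x 0) * ((q:ℝ) - x 1) * ((q:ℝ) - x 0 * x 1))) ∧
      (2:ℕ) • of Vq - ((2:ℕ) • of D + of P) ∈ relations ∧ of Tq - of D ∈ relations := by
  obtain ⟨hex, ⟨Tr, hTrd, hTri⟩, -, -⟩ := isl_carriers q hq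
  obtain ⟨Vq, hVqd, hVqi⟩ := hex (fun x => (q:ℝ) / (((q:ℝ) - x 0) * ((q:ℝ) - x 0 * x 1))) (by simp)
  obtain ⟨Vq', hVq'd, hVq'i⟩ := hex (fun x => (q:ℝ) / (((q:ℝ) - x 1) * ((q:ℝ) - x 0 * x 1))) (by simp)
  obtain ⟨D, hDd, hDi⟩ := hex (fun x => 1 / ((q:ℝ) - x 0 * x 1)) (by simp)
  obtain ⟨W, hWd, hWi⟩ := hex (fun x => x 0 / (((q:ℝ) - x 0) * ((q:ℝ) - x 0 * x 1))) (by simp)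
  obtain ⟨P, hPd, hPi⟩ := hex (fun x => 1 / (((q:ℝ) - x 0) * ((q:ℝ) - x 1))) (by simp)
  obtain ⟨Tq, hTqd, hTqi⟩ := hex (fun x => (q:ℝ) * ((q:ℝ) - 1) /
    (((q:ℝ) - x 0) * ((q:ℝ) - x 1) * ((q:ℝ) - x 0 * x 1))) (by simp)
  have hsplit := isl_split_qV q hq Vq D W hVqd (hVqi ▸ fun _ _ => rfl) hDd (hDi ▸ fun _ _ => rfl)
    hWd (hWi ▸ fun _ _ => rfl)
  have hchart := isl_chart_W q hq W Tr hWd (hWi ▸ fun _ _ => rfl) hTrd (hTri ▸ fun _ _ => rfl)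
  have hdiss := isl_dissect_P q hq P Tr hPd (hPi ▸ fun _ _ => rfl) hTrd (hTri ▸ fun _ _ => rfl)
  obtain ⟨hpf, hswap⟩ := isl_partialFraction_T q hq Tq D Vq Vq' P hTqd (hTqi ▸ fun _ _ => rfl)
    hDd (hDi ▸ fun _ _ => rfl) hVqd (hVqi ▸ fun _ _ => rfl) hVq'd (hVq'i ▸ fun _ _ => rfl)
    hPd (hPi ▸ fun _ _ => rfl)
  have hV2 : (2:ℕ) • of Vq - ((2:ℕ) • of D + of P) ∈ relations := by
    have e : (2:ℕ) • of Vq - ((2:ℕ) • of D + of P) =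
        (2:ℕ) • (of Vq - of D - of W) + (2:ℕ) • (of W - of Tr) - (of P - (2:ℕ) • of Tr) := by
      simp only [smul_sub]; abel
    rw [e]
    exact relations.sub_mem (relations.add_mem (relations.nsmul_mem hsplit 2)
      (relations.nsmul_mem hchart 2)) hdiss
  have hT1 : of Tq - of D ∈ relations := by
    have e : of Tq - of D = (of Tq + of D - of Vq - of Vq' + of P) + (of Vq' - of Vq)
        + ((2:ℕ) • of Vq - ((2:ℕ) • of D + of P)) := by
      simp only [two_nsmul]; abel
    rw [e]
    exact relations.add_mem (relations.add_mem hpf hswap) hV2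
  exact ⟨Vq, D, P, Tq, hVqd, hVqi, hDd, hDi, hPd, hPi, hTqd, hTqi, hV2, hT1⟩

/-- **`MixedAtomSplit`** (strategist's first target, M): `[□², 2q/((q−x)(q−xy))] ∼ [□², 2/(q−xy) + 1/((q−x)(q−y))]`
(`2qV₁ = 2Li₂(1/q) + ℓ²`) — transcendence-free, by the island's move chains. [cite: KontsevichZagier2001, §1.2 rules (1), (2)] -/
theorem island_mixedAtomSplit : ∀ (q : ℕ), 2 ≤ q → ∀ (r r' : IntegralRep 2),
    r.domain = {x | ∀ i, x i ∈ Set.Ioo (0:ℝ) 1} →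
    EqOn r.integrand (fun x => 2 * (q:ℝ) / (((q:ℝ) - x 0) * ((q:ℝ) - x 0 * x 1))) r.domain →
    r'.domain = {x | ∀ i, x i ∈ Set.Ioo (0:ℝ) 1} →
    EqOn r'.integrand (fun x => 2 / ((q:ℝ) - x 0 * x 1) + 1 / (((q:ℝ) - x 0) * ((q:ℝ) - x 1))) r'.domain →
    Equivalent r r' := by
  intro q hq r r' hrd hri hr'd hr'i
  obtain ⟨Vq, D, P, -, hVqd, hVqi, hDd, hDi, hPd, hPi, -, -, hV2, -⟩ := islk_chains q hq
  have h1 : of r - (2:ℕ) • of Vq ∈ relations :=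
    islk_of_sub_nsmul 2 Vq r (hVqd.trans hrd.symm) fun x hx => by
      simp only [hri hx, hVqi]; push_cast; ring
  have h2 : of r' - ((2:ℤ) • of D + (1:ℤ) • of P) ∈ relations := by
    have h := aff_orbit_of_sub_sum_zsmul_mem_relations (Finset.univ : Finset (Fin 2)) ![D, P] ![2, 1] r'
      (fun i _ => by
        fin_cases i
        · exact hDd.trans hr'd.symm
        · exact hPd.trans hr'd.symm) fun x hx => by
        simp only [Fin.sum_univ_two, Matrix.cons_val_zero, Matrix.cons_val_one, hr'i hx, hDi, hPi]
        push_cast; ring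
    simpa [Fin.sum_univ_two] using h
  show of r - of r' ∈ relations
  have e : of r - of r' = (of r - (2:ℕ) • of Vq) + ((2:ℕ) • of Vq - ((2:ℕ) • of D + of P))
      - (of r' - ((2:ℤ) • of D + (1:ℤ) • of P)) := by
    simp only [one_smul, ← natCast_zsmul]; push_cast; abel
  rw [e]
  exact relations.sub_mem (relations.add_mem h1 hV2) h2

/-- **`TriplePoleLanden`** (strategist's second target, M): the triple-pole box is the dilogarithm box
over `q(q−1)`: `[□², q(q−1)/((q−x)(q−y)(q−xy))] ∼ [□², 1/(q−xy)]` — transcendence-free.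
[cite: KontsevichZagier2001, §1.2 rules (1), (2)] -/
theorem island_triplePole : ∀ (q : ℕ), 2 ≤ q → ∀ (r r' : IntegralRep 2),
    r.domain = {x | ∀ i, x i ∈ Set.Ioo (0:ℝ) 1} →
    EqOn r.integrand (fun x => (q:ℝ) * ((q:ℝ) - 1) /
      (((q:ℝ) - x 0) * ((q:ℝ) - x 1) * ((q:ℝ) - x 0 * x 1))) r.domain →
    r'.domain = {x | ∀ i, x i ∈ Set.Ioo (0:ℝ) 1} →
    EqOn r'.integrand (fun x => 1 / ((q:ℝ) - x 0 * x 1)) r'.domain →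
    Equivalent r r' := by
  intro q hq r r' hrd hri hr'd hr'i
  obtain ⟨-, D, -, Tq, -, -, hDd, hDi, -, -, hTqd, hTqi, -, hT1⟩ := islk_chains q hq
  have h1 : of r - of Tq ∈ relations :=
    of_sub_of_mem_relations_of_eqOn (hTqd.trans hrd.symm) fun x hx => by rw [hri hx, hTqi]
  have h2 : of D - of r' ∈ relations :=
    of_sub_of_mem_relations_of_eqOn (hr'd.trans hDd.symm) fun x hx => by
      rw [hDi, hr'i (by rw [hr'd, ← hDd]; exact hx)]
  show of r - of r' ∈ relations
  have e : of r - of r' = (of r - of Tq) + (of Tq - of D) + (of D - of r') := by abel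
  rw [e]
  exact relations.add_mem (relations.add_mem h1 hT1) h2

/-- **Conjecture 1 (kernel form) on the PRODUCT ISLAND at height `q`**, conditional on the
`ℚ`-linear independence of `1, ℓ = ∫₀¹dt/(q−t), L₂ = ∫_□² dxdy/(q−xy), ℓ²` (Viola–Zudilin 2018 for
`q ≥ 9`): a formal `ℤ`-combination of the eight island atoms with vanishing value is a KZ relation.
[cite: KontsevichZagier2001, §1.2 Conjecture 1] [cite: ViolaZudilin2018, Thm 1] -/
theorem island_mem_relations_of_eval_eq_zero (q : ℕ) (hq : 2 ≤ q)
    (hrig : ∀ a b c d : ℚ,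
      (a:ℝ) + b * (∫ t in Set.Ioo (0:ℝ) 1, 1 / ((q:ℝ) - t)) +
        c * (∫ x in {x : Fin 2 → ℝ | ∀ i, x i ∈ Set.Ioo (0:ℝ) 1}, 1 / ((q:ℝ) - x 0 * x 1)) +
        d * (∫ t in Set.Ioo (0:ℝ) 1, 1 / ((q:ℝ) - t)) ^ 2 = 0 → a = 0 ∧ b = 0 ∧ c = 0 ∧ d = 0)
    {c : FormalRep}
    (hc : c ∈ AddSubgroup.closure
      ({y : FormalRep | ∃ N : IntegralRep 2, N.domain = {x | ∀ i, x i ∈ Set.Ioo (0:ℝ) 1} ∧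
          EqOn N.integrand (fun _ => (1:ℝ)) N.domain ∧ y = of N} ∪
       {y : FormalRep | ∃ N : IntegralRep 2, N.domain = {x | ∀ i, x i ∈ Set.Ioo (0:ℝ) 1} ∧
          EqOn N.integrand (fun x => 1 / ((q:ℝ) - x 0)) N.domain ∧ y = of N} ∪
       {y : FormalRep | ∃ N : IntegralRep 2, N.domain = {x | ∀ i, x i ∈ Set.Ioo (0:ℝ) 1} ∧
          EqOn N.integrand (fun x => 1 / ((q:ℝ) - x 1)) N.domain ∧ y = of N} ∪
       {y : FormalRep | ∃ N : IntegralRep 2, N.domain = {x | ∀ i, x i ∈ Set.Ioo (0:ℝ) 1} ∧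
          EqOn N.integrand (fun x => 1 / ((q:ℝ) - x 0 * x 1)) N.domain ∧ y = of N} ∪
       {y : FormalRep | ∃ N : IntegralRep 2, N.domain = {x | ∀ i, x i ∈ Set.Ioo (0:ℝ) 1} ∧
          EqOn N.integrand (fun x => 1 / (((q:ℝ) - x 0) * ((q:ℝ) - x 1))) N.domain ∧ y = of N} ∪
       {y : FormalRep | ∃ N : IntegralRep 2, N.domain = {x | ∀ i, x i ∈ Set.Ioo (0:ℝ) 1} ∧
          EqOn N.integrand (fun x => 1 / (((q:ℝ) - x 0) * ((q:ℝ) - x 0 * x 1))) N.domain ∧ y = of N} ∪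
       {y : FormalRep | ∃ N : IntegralRep 2, N.domain = {x | ∀ i, x i ∈ Set.Ioo (0:ℝ) 1} ∧
          EqOn N.integrand (fun x => 1 / (((q:ℝ) - x 1) * ((q:ℝ) - x 0 * x 1))) N.domain ∧ y = of N} ∪
       {y : FormalRep | ∃ N : IntegralRep 2, N.domain = {x | ∀ i, x i ∈ Set.Ioo (0:ℝ) 1} ∧
          EqOn N.integrand (fun x => 1 / (((q:ℝ) - x 0) * ((q:ℝ) - x 1) * ((q:ℝ) - x 0 * x 1))) N.domain ∧ y = of N}))
    (hv : eval c = 0) : c ∈ relations := by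
  -- carriers, references and the two chains
  obtain ⟨hex, -, hONEv, hLPv⟩ := isl_carriers q hq
  obtain ⟨Vq, D, P, Tq, hVqd, hVqi, hDd, hDi, hPd, hPi, hTqd, hTqi, hV2, hT1⟩ := islk_chains q hq
  obtain ⟨Vq', hVq'd, hVq'i⟩ := hex (fun x => (q:ℝ) / (((q:ℝ) - x 1) * ((q:ℝ) - x 0 * x 1))) (by simp)
  obtain ⟨L, hLd, hLi⟩ := hex (fun x => 1 / ((q:ℝ) - x 0)) (by simp)
  obtain ⟨ONE, hONEd, hONEi⟩ := hex (fun _ => (1:ℝ)) (by simp)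
  have hswap : of Vq' - of Vq ∈ relations :=
    islk_swap Vq Vq' (fun x => (q:ℝ) / (((q:ℝ) - x 0) * ((q:ℝ) - x 0 * x 1))) hVqd
      (hVqi ▸ fun _ _ => rfl) hVq'd fun x _ => by
      simp only [hVq'i, Matrix.cons_val_zero, Matrix.cons_val_one]
      rw [mul_comm (x 1) (x 0)]
  -- the normal form `F•c ≡ α[1] + β[L] + γ[D] + δ[P]`, `F = 2q(q−1)`
  set F : ℕ := 2 * q * (q - 1) with hF
  have hq1 : 1 ≤ q := by omega
  have hFpos : 0 < F := by
    have : 0 < q - 1 := by omega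
    positivity
  have hred : ∀ c ∈ AddSubgroup.closure
      ({y : FormalRep | ∃ N : IntegralRep 2, N.domain = {x | ∀ i, x i ∈ Set.Ioo (0:ℝ) 1} ∧
          EqOn N.integrand (fun _ => (1:ℝ)) N.domain ∧ y = of N} ∪
       {y : FormalRep | ∃ N : IntegralRep 2, N.domain = {x | ∀ i, x i ∈ Set.Ioo (0:ℝ) 1} ∧
          EqOn N.integrand (fun x => 1 / ((q:ℝ) - x 0)) N.domain ∧ y = of N} ∪
       {y : FormalRep | ∃ N : IntegralRep 2, N.domain = {x | ∀ i, x i ∈ Set.Ioo (0:ℝ) 1} ∧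
          EqOn N.integrand (fun x => 1 / ((q:ℝ) - x 1)) N.domain ∧ y = of N} ∪
       {y : FormalRep | ∃ N : IntegralRep 2, N.domain = {x | ∀ i, x i ∈ Set.Ioo (0:ℝ) 1} ∧
          EqOn N.integrand (fun x => 1 / ((q:ℝ) - x 0 * x 1)) N.domain ∧ y = of N} ∪
       {y : FormalRep | ∃ N : IntegralRep 2, N.domain = {x | ∀ i, x i ∈ Set.Ioo (0:ℝ) 1} ∧
          EqOn N.integrand (fun x => 1 / (((q:ℝ) - x 0) * ((q:ℝ) - x 1))) N.domain ∧ y = of N} ∪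
       {y : FormalRep | ∃ N : IntegralRep 2, N.domain = {x | ∀ i, x i ∈ Set.Ioo (0:ℝ) 1} ∧
          EqOn N.integrand (fun x => 1 / (((q:ℝ) - x 0) * ((q:ℝ) - x 0 * x 1))) N.domain ∧ y = of N} ∪
       {y : FormalRep | ∃ N : IntegralRep 2, N.domain = {x | ∀ i, x i ∈ Set.Ioo (0:ℝ) 1} ∧
          EqOn N.integrand (fun x => 1 / (((q:ℝ) - x 1) * ((q:ℝ) - x 0 * x 1))) N.domain ∧ y = of N} ∪
       {y : FormalRep | ∃ N : IntegralRep 2, N.domain = {x | ∀ i, x i ∈ Set.Ioo (0:ℝ) 1} ∧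
          EqOn N.integrand (fun x => 1 / (((q:ℝ) - x 0) * ((q:ℝ) - x 1) * ((q:ℝ) - x 0 * x 1))) N.domain ∧ y = of N}),
      ∃ (α β γ δ : ℤ), F • c - (α • of ONE + β • of L + γ • of D + δ • of P) ∈ relations := by
    intro c hc
    induction hc using AddSubgroup.closure_induction with
    | mem y hy =>
      simp only [mem_union, mem_setOf_eq] at hy
      rcases hy with (((((((⟨N, hNd, hNi, rfl⟩ | ⟨N, hNd, hNi, rfl⟩) | ⟨N, hNd, hNi, rfl⟩) | ⟨N, hNd, hNi, rfl⟩) | ⟨N, hNd, hNi, rfl⟩) | ⟨N, hNd, hNi, rfl⟩) | ⟨N, hNd, hNi, rfl⟩) | ⟨N, hNd, hNi, rfl⟩)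
      · -- `[1]`
        refine ⟨F, 0, 0, 0, ?_⟩
        have h : of N - of ONE ∈ relations :=
          of_sub_of_mem_relations_of_eqOn (hONEd.trans hNd.symm) fun x hx => by rw [hNi hx, hONEi]
        have e : F • of N - ((F:ℤ) • of ONE + (0:ℤ) • of L + (0:ℤ) • of D + (0:ℤ) • of P) =
            F • (of N - of ONE) := by
          simp only [zero_smul, add_zero, smul_sub, natCast_zsmul]
        rw [e]; exact relations.nsmul_mem h _
      · -- `[1/(q−x)]`
        refine ⟨0, F, 0, 0, ?_⟩
        have h : of N - of L ∈ relations :=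
          of_sub_of_mem_relations_of_eqOn (hLd.trans hNd.symm) fun x hx => by rw [hNi hx, hLi]
        have e : F • of N - ((0:ℤ) • of ONE + (F:ℤ) • of L + (0:ℤ) • of D + (0:ℤ) • of P) =
            F • (of N - of L) := by
          simp only [zero_smul, add_zero, zero_add, smul_sub, natCast_zsmul]
        rw [e]; exact relations.nsmul_mem h _
      · -- `[1/(q−y)]`: swap onto `L`
        refine ⟨0, F, 0, 0, ?_⟩
        have h : of N - of L ∈ relations :=
          islk_swap L N (fun x => 1 / ((q:ℝ) - x 0)) hLd (hLi ▸ fun _ _ => rfl) hNd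
            (fun x hx => by rw [hNi hx]; simp)
        have e : F • of N - ((0:ℤ) • of ONE + (F:ℤ) • of L + (0:ℤ) • of D + (0:ℤ) • of P) =
            F • (of N - of L) := by
          simp only [zero_smul, add_zero, zero_add, smul_sub, natCast_zsmul]
        rw [e]; exact relations.nsmul_mem h _
      · -- `[1/(q−xy)]`
        refine ⟨0, 0, F, 0, ?_⟩
        have h : of N - of D ∈ relations :=
          of_sub_of_mem_relations_of_eqOn (hDd.trans hNd.symm) fun x hx => by rw [hNi hx, hDi]
        have e : F • of N - ((0:ℤ) • of ONE + (0:ℤ) • of L + (F:ℤ) • of D + (0:ℤ) • of P) =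
            F • (of N - of D) := by
          simp only [zero_smul, add_zero, zero_add, smul_sub, natCast_zsmul]
        rw [e]; exact relations.nsmul_mem h _
      · -- `[1/((q−x)(q−y))]`
        refine ⟨0, 0, 0, F, ?_⟩
        have h : of N - of P ∈ relations :=
          of_sub_of_mem_relations_of_eqOn (hPd.trans hNd.symm) fun x hx => by rw [hNi hx, hPi]
        have e : F • of N - ((0:ℤ) • of ONE + (0:ℤ) • of L + (0:ℤ) • of D + (F:ℤ) • of P) =
            F • (of N - of P) := by
          simp only [zero_smul, zero_add, smul_sub, natCast_zsmul]
        rw [e]; exact relations.nsmul_mem h _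
      · -- `V = [1/((q−x)(q−xy))]`: `q[N] ≡ [Vq]`, `2[Vq] ≡ 2[D] + [P]`
        refine ⟨0, 0, 2 * ((q:ℤ) - 1), (q:ℤ) - 1, ?_⟩
        have hN : of Vq - q • of N ∈ relations :=
          islk_of_sub_nsmul q N Vq (hNd.trans hVqd.symm) fun x hx => by
            simp only [hVqi, hNi (by rw [hNd, ← hVqd]; exact hx)]
            rw [div_eq_mul_one_div]
        have e : F • of N - ((0:ℤ) • of ONE + (0:ℤ) • of L + (2 * ((q:ℤ) - 1)) • of D + ((q:ℤ) - 1) • of P) =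
            -(((q:ℤ) - 1) • ((2:ℤ) • (of Vq - q • of N)))
            + (((q:ℤ) - 1) • ((2:ℕ) • of Vq - ((2:ℕ) • of D + of P))) := by
          rw [hF]
          simp only [← natCast_zsmul]
          push_cast [Nat.cast_sub hq1]
          module
        rw [e]
        exact relations.add_mem (relations.neg_mem (relations.zsmul_mem (relations.zsmul_mem hN 2) _))
          (relations.zsmul_mem hV2 _)
      · -- `V' = [1/((q−y)(q−xy))]`: `q[N] ≡ [Vq'] ≡ [Vq]`
        refine ⟨0, 0, 2 * ((q:ℤ) - 1), (q:ℤ) - 1, ?_⟩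
        have hN : of Vq' - q • of N ∈ relations :=
          islk_of_sub_nsmul q N Vq' (hNd.trans hVq'd.symm) fun x hx => by
            simp only [hVq'i, hNi (by rw [hNd, ← hVq'd]; exact hx)]
            rw [div_eq_mul_one_div]
        have hN' : of Vq - q • of N ∈ relations := by
          have e : of Vq - q • of N = (of Vq' - q • of N) - (of Vq' - of Vq) := by abel
          rw [e]; exact relations.sub_mem hN hswap
        have e : F • of N - ((0:ℤ) • of ONE + (0:ℤ) • of L + (2 * ((q:ℤ) - 1)) • of D + ((q:ℤ) - 1) • of P) =
            -(((q:ℤ) - 1) • ((2:ℤ) • (of Vq - q • of N)))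
            + (((q:ℤ) - 1) • ((2:ℕ) • of Vq - ((2:ℕ) • of D + of P))) := by
          rw [hF]
          simp only [← natCast_zsmul]
          push_cast [Nat.cast_sub hq1]
          module
        rw [e]
        exact relations.add_mem (relations.neg_mem (relations.zsmul_mem (relations.zsmul_mem hN' 2) _))
          (relations.zsmul_mem hV2 _)
      · -- `T = [1/((q−x)(q−y)(q−xy))]`: `q(q−1)[N] ≡ [Tq] ≡ [D]`
        refine ⟨0, 0, 2, 0, ?_⟩
        have hN : of Tq - (q * (q - 1)) • of N ∈ relations :=
          islk_of_sub_nsmul (q * (q - 1)) N Tq (hNd.trans hTqd.symm) fun x hx => by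
            simp only [hTqi, hNi (by rw [hNd, ← hTqd]; exact hx)]
            push_cast [Nat.cast_sub hq1]
            rw [div_eq_mul_one_div]
        have e : F • of N - ((0:ℤ) • of ONE + (0:ℤ) • of L + (2:ℤ) • of D + (0:ℤ) • of P) =
            -((2:ℤ) • (of Tq - (q * (q - 1)) • of N)) + (2:ℤ) • (of Tq - of D) := by
          rw [hF]
          simp only [← natCast_zsmul]
          push_cast [Nat.cast_sub hq1]
          module
        rw [e]
        exact relations.add_mem (relations.neg_mem (relations.zsmul_mem hN 2)) (relations.zsmul_mem hT1 2)
    | zero => exact ⟨0, 0, 0, 0, by simp [relations.zero_mem]⟩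
    | add y z _ _ ihy ihz =>
      obtain ⟨α₁, β₁, γ₁, δ₁, h₁⟩ := ihy
      obtain ⟨α₂, β₂, γ₂, δ₂, h₂⟩ := ihz
      refine ⟨α₁ + α₂, β₁ + β₂, γ₁ + γ₂, δ₁ + δ₂, ?_⟩
      have e : F • (y + z) - ((α₁ + α₂) • of ONE + (β₁ + β₂) • of L + (γ₁ + γ₂) • of D + (δ₁ + δ₂) • of P) =
          (F • y - (α₁ • of ONE + β₁ • of L + γ₁ • of D + δ₁ • of P)) +
            (F • z - (α₂ • of ONE + β₂ • of L + γ₂ • of D + δ₂ • of P)) := by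
        simp only [smul_add, add_smul]; abel
      rw [e]
      exact relations.add_mem h₁ h₂
    | neg y _ ih =>
      obtain ⟨α, β, γ, δ, h⟩ := ih
      refine ⟨-α, -β, -γ, -δ, ?_⟩
      have e : F • (-y) - ((-α) • of ONE + (-β) • of L + (-γ) • of D + (-δ) • of P) =
          -(F • y - (α • of ONE + β • of L + γ • of D + δ • of P)) := by
        simp only [smul_neg, neg_smul]; abel
      rw [e]
      exact relations.neg_mem h
  -- values of the references
  obtain ⟨α, β, γ, δ, h⟩ := hred c hc
  have hONE : ONE.value = 1 := hONEv ONE hONEd hONEi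
  obtain ⟨hLv, hPv⟩ := hLPv L P hLd hLi hPd hPi
  have hDv : D.value = ∫ x in {x : Fin 2 → ℝ | ∀ i, x i ∈ Set.Ioo (0:ℝ) 1}, 1 / ((q:ℝ) - x 0 * x 1) := by
    rw [IntegralRep.value, hDd, hDi]
  have hev := relations_le_ker_eval_holds h
  rw [AddMonoidHom.mem_ker, map_sub, map_nsmul, hv, smul_zero, zero_sub, neg_eq_zero, map_add, map_add,
    map_add, map_zsmul, map_zsmul, map_zsmul, map_zsmul, eval_of, eval_of, eval_of, eval_of, hONE, hLv,
    hDv, hPv] at hev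
  simp only [zsmul_eq_mul, mul_one] at hev
  obtain ⟨hα, hβ, hγ, hδ⟩ := hrig α β γ δ (by push_cast; linarith)
  have hα' : α = 0 := by exact_mod_cast hα
  have hβ' : β = 0 := by exact_mod_cast hβ
  have hγ' : γ = 0 := by exact_mod_cast hγ
  have hδ' : δ = 0 := by exact_mod_cast hδ
  subst hα' hβ' hγ' hδ'
  simp only [zero_smul, add_zero, sub_zero] at h
  exact mem_relations_of_nsmul_mem hFpos h

end Summit.KontsevichZagierPeriods.HurwitzMicroSectors.NormalFormPrinciple.PiBox.Island
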